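import Summits.ResolutionOfSingularities.ResolutionOfSingularities.Theorems.FrobeniusClosingPatchingRelPerfectDepthPhaseCX3Defs
import HarnessLib

/-!
# Crux `PatchingRelPerfect` (stmt-ResolutionOfSingularities-16161), chain W5.2 — F7(β) (β-AX) X3 C-I: THE CONTACT FORM OF RECORD, rev 6
# (second sibling of the X3 definitions; `…DepthPhaseCX3DefsPieces.lean` holds revs 1–5 and is at the 400-line cap)

[OURS · L1 W5.2 · res-L1-w52-lead-1 g6 (typer / record keeper / cure hand); history: Sketch v23 §4.4b (rev 1), tri-2 carrier guards (rev 2),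
stalkwise principal entries K26 (rev 3), carrier not a member (rev 4) / not even at the stalk (rev 5), patch-uniform carrier/entries/NF0 (rev 6).]
STATEMENTS ONLY; nothing here is a statement of the manuscript under review; AI-written, AI review weaker than expert review; counted 0.
`HasContactFormOnPw₆` is the contact classification target along a closed piece `P` (pointwise carrier from a list, one global entry list,
pointwise stalk equation / NF1 / local snc, PATCH-UNIFORM order-one principal carrier, principal entries and NF0, closed contact set with LEG);
`ContactCure₃Pw₆` the cure per piece on every open around it; `ContactCureReduction₃Pw₆ : F-60 → ContactCure₃Pw₆` the reduction TARGET OF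
RECORD, consumed by `X3LemmaM.phaseCOne_cylReach_of_contactCure₆` (…PhaseCOneContact rev 6).

## References
* V. Cossart, U. Jannsen, S. Saito, arXiv:0905.2191v2 (2020), Thm. 1.4, Def. 6.8, Thm. 6.9 (a). [CossartJannsenSaito2020]
* E. Bierstone, D. Grigoriev, P. Milman, J. Włodarczyk, arXiv:1206.3090, Def. 3.1.1, Thm. 8.0.5. [BierstoneGrigorievMilmanWlodarczyk2011]
-/

-- `Summit.<Summit>.<Sub>.Theorems` with `Sub = Summit` (single-conjunct summit, D-0017)
set_option linter.dupNamespace false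

noncomputable section

namespace Summit.ResolutionOfSingularities.ResolutionOfSingularities.Theorems.X3LemmaM

open CategoryTheory AlgebraicGeometry TopologicalSpace IsLocalRing
open Literature.AlgebraicGeometry.Resolution
open Scheme.IdealSheafData
open Summit.ResolutionOfSingularities.ResolutionOfSingularities.Theorems.DepthMultiHost

universe u

variable {X : Scheme.{u}}

/-! ## rev 6 (2026-08-27T23:3xZ) PATCH-UNIFORM CARRIER / ENTRIES / NF0.  The cure΄s dimension hypothesis («`(Sfc ∩ W)_red` has dimension
`≤ 2`», F-60) is a count `dim 𝒪_z ⧸ (v, ∏ φ_c) = dim 𝒪_z − 2 ≤ 2` at EVERY point `z` of the contact surface near `x`, which needs the carrier to be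
an order-one principal hypersurface, the entries to be principal and NF0 to hold AT `z` — rev 5 had these only at the points of `P`.  They do
propagate from `x` to a neighbourhood (regular hypersurfaces are locally irreducible), but the classification shrinks its patch anyway, so the
form now carries them on the patch `W` (three clauses inside the pointwise block; everything else verbatim).  TARGETS OF RECORD = `₆`. -/

open Classical in
/-- [OURS · L1 W5.2] **CONTACT FORM along a piece, POINTWISE CARRIER, rev 6** = rev 5 + patch-uniform «carrier order-one principal along
`Supp V ∩ W`», «entries stalkwise principal on `W`», «NF0 on `W`».  NOT a statement of the manuscript. -/
def HasContactFormOnPw₆ (S : MultiHostState X) (P : Set X) : Prop :=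
  ∃ (U : X.Opens) (_ : P ⊆ (U : Set X)) (Sfc : Set X) (hSfc : IsClosed Sfc) (𝓥 : List X.IdealSheafData)
    (𝓒 : List (List (X.IdealSheafData × ℕ) × X.IdealSheafData)) (𝓟 : List (X.IdealSheafData × ℕ)),
    -- entries: monomials on members meeting `P`; the pure entry; legality of the pure entry at every `x ∈ P`
    (∀ c ∈ 𝓒, ∀ p ∈ c.1, p.1 ∈ S.𝓔 ∧ ((p.1.support : Set X) ∩ P).Nonempty) ∧
    (𝓟, (⊤ : X.IdealSheafData)) ∈ 𝓒 ∧
    (∀ x ∈ P, ∀ T ∈ S.𝓔, x ∈ (T.support : Set X) → stalkIdeal (monomialIdeal 𝓟) x ≤ stalkIdeal T x) ∧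
    -- entries stalkwise PRINCIPAL along `P` (rev 3: needed for F-60΄s «no component in the boundary» via Krull)
    (∀ x ∈ P, ∀ c ∈ 𝓒, ∃ φ : X.presheaf.stalk x, stalkIdeal c.2 x = Ideal.span {φ}) ∧
    -- pointwise carrier from the list `𝓥`, NOT A MEMBER, NOT EVEN AT THE STALK (rev 4/5: else the contact surface lies in the boundary near `x`)
    (∀ x ∈ P, ∃ V ∈ 𝓥, V ∉ S.𝓔 ∧ (∀ T ∈ S.𝓔, x ∈ (T.support : Set X) → stalkIdeal V x ≠ stalkIdeal T x) ∧
      ∃ W : X.Opens, x ∈ (W : Set X) ∧ (W : Set X) ⊆ (U : Set X) ∧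
      (∃ v : X.presheaf.stalk x, v ∉ (maximalIdeal (X.presheaf.stalk x)) ^ 2 ∧ stalkIdeal V x = Ideal.span {v}) ∧
      -- rev 6, PATCH-UNIFORM clauses (the cure΄s dimension count needs them at every point of the contact surface near `x`, not only at `x`):
      -- the carrier is an order-one principal hypersurface along `Supp V ∩ W`, the entries are stalkwise principal on `W`, and NF0 holds on `W`
      (∀ z ∈ (W : Set X), z ∈ (V.support : Set X) →
        ∃ w : X.presheaf.stalk z, w ∉ (maximalIdeal (X.presheaf.stalk z)) ^ 2 ∧ stalkIdeal V z = Ideal.span {w}) ∧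
      (∀ z ∈ (W : Set X), ∀ c ∈ 𝓒, ∃ φ : X.presheaf.stalk z, stalkIdeal c.2 z = Ideal.span {φ}) ∧
      (∀ z ∈ (W : Set X), z ∈ (V.support : Set X) → ∀ c ∈ 𝓒, c.2 ≠ V → z ∈ (c.2.support : Set X) →
        ¬ stalkIdeal c.2 z ≤ stalkIdeal V z) ∧
      HasSNC ((V :: S.𝓔.filter fun T => decide (x ∈ (T.support : Set X))).map fun F => F.comap W.ι) ∧
      (∀ c ∈ 𝓒, c.2 ≠ V → x ∈ (c.2.support : Set X) →
        ¬ stalkIdeal c.2 x ≤ stalkIdeal V x ∧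
        ∀ T ∈ S.𝓔, x ∈ (T.support : Set X) → ¬ stalkIdeal c.2 x ≤ stalkIdeal V x ⊔ stalkIdeal T x) ∧
      stalkIdeal S.residual.K x = stalkIdeal V x ⊔ ⨆ c ∈ 𝓒, stalkIdeal (monomialIdeal c.1) x * stalkIdeal c.2 x ∧
      Sfc ∩ (W : Set X) = (V.support : Set X) ∩ (⋃ c ∈ 𝓒, ⋃ (_ : c.2 ≠ V), (c.2.support : Set X)) ∩ (W : Set X)) ∧
    -- LEG, carrier-free: on `U`, Sing Σ ∪ (Σ ∩ B) ⊆ P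
    (let 𝒵 : X.IdealSheafData := Scheme.IdealSheafData.vanishingIdeal ⟨Sfc, hSfc⟩
     let Sing : Set X := 𝒵.subschemeι.base '' (Scheme.regularLocus 𝒵.subscheme)ᶜ
     let B : Set X := ⋃ T ∈ S.𝓔, (T.support : Set X)
     ∀ y ∈ (U : Set X), (y ∈ Sing ∨ (y ∈ Sfc ∧ y ∈ B)) → y ∈ P)






/-- [OURS · L1 W5.2] **(M2b) CONTACT CURE PER PIECE, rev 6** = `ContactCure₃Pw` verbatim over `HasContactFormOnPw₆`. -/
def ContactCure₃Pw₆ : Prop :=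
  ∀ (X : Scheme.{u}) [IsNoetherian X], Scheme.IsRegular X → Scheme.IsExcellent X → topologicalKrullDim X ≤ 4 →
    ∀ (S : MultiHostState X) (P : TopologicalSpace.Closeds X), (P : Set X) ⊆ (S.residual.K.support : Set X) →
      HasContactFormOnPw₆ S (P : Set X) →
      ∀ U : X.Opens, (P : Set X) ⊆ (U : Set X) →
        ∃ s : CentreSeq (U : Scheme.{u}), s.AllRegular ∧ s.CentresOver (U.ι.base ⁻¹' (P : Set X)) ∧ Scheme.IsRegular s.top ∧
          ∃ 𝓛' : List s.top.IdealSheafData,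
            ∀ x' ∈ ((((S.residual.K.comap U.ι).comap s.comp).support : Set s.top)),
              s.comp.base x' ∈ U.ι.base ⁻¹' (P : Set X) → IsEndNear ((S.residual.K.comap U.ι).comap s.comp) 𝓛' x'

/-- [OURS · L1 W5.2] **(M2b-S) ⇒ (M2b) per piece, rev 6** — the F-60 reduction TARGET OF RECORD. -/
def ContactCureReduction₃Pw₆ : Prop :=
  CossartJannsenSaito2020EmbeddedSequenceBoundary.{u} → ContactCure₃Pw₆.{u}


end Summit.ResolutionOfSingularities.ResolutionOfSingularities.Theorems.X3LemmaM

end
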